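import Summits.ResolutionOfSingularities.ResolutionOfSingularities.Theorems.EquisingularLiftEquisingularLiftNatCarrierDeltaFrameAdapted
import HarnessLib

/-!
# [OURS · L1 W4.5(b) · EL♮(3)] S7 — T-FRAME-AT′: the section frame adapted to a closed point of the exceptional divisor, STARTING FROM A
# GIVEN SECTION FRAME and recording the translate-and-swap relation (crux `EquisingularLiftNatThree` = stmt-ResolutionOfSingularities-20148)

res-type-100 g12, object S7 `hBaseKCL` (res-D-pv-029 TOWER₃ assembly; res-L1-w45b-plan-1 CHAIN v7.31 §1(1)), centred chain. OURS; NOT a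
statement of any manuscript; AI-written, weaker than expert review; `--supports stmt-ResolutionOfSingularities-20148 --as helper`; closes
nothing. Definition-free.

WHY (res-type-100 FINDING-2, STATUS 2026-08-27T21:05:50Z): the cone-form exactness of the Member's cone survives only k-AFFINE frame changes,
so the centred member's adapted frame (res-L1-w45b-stub-1's T-FRAME-AT `exists_sectionFrame_adapted`, …NatCarrierDeltaFrameAdapted, which
starts from an ARBITRARY frame) must start from the LIFT of the `ConeForm` frame and the change must be recorded.

* `exists_translate_swap_coords'` — `exists_translate_swap_coords` with the explicit relation `c₀ i = c (swap 0 jj i) + w̃ i · c 0`.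
* `exists_sectionFrame_adapted_of_frame` — T-FRAME-AT from a GIVEN section frame `c₀` (`(c₀) = 𝓘(s)_{j x}`): the adapted frame `c`
  (all frame clauses, the presentation of `𝒪_{F₂,q′}` on the chart `c̄₀` with `q′ = [1:0:0]`) AND constants `o : Fin 3 → O` and a chart
  index `jj` with `c₀ i = c (swap 0 jj i) + ι(o i) · c 0` — the values of the chart coordinates at `q′` are lifted to CONSTANTS `ι(o l)`
  through the residue model `π₀ : O ↠ κ(x)` (`residueModel_surjective_and_ker`), which is what makes the change k-affine downstairs.

References: The Stacks Project, Tag 0804; H. Matsumura, *Commutative Ring Theory* (1986), Thm. 14.2 — through the cited tree file.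
-/

set_option linter.dupNamespace false -- mandated namespace `Summit.<Summit>.<Problem>` of this single-conjunct summit
set_option linter.overlappingInstances false -- signatures carry `[IsDomain O] [IsDiscreteValuationRing O]`

noncomputable section

open CategoryTheory CategoryTheory.Limits AlgebraicGeometry TopologicalSpace IsLocalRing
open Literature.AlgebraicGeometry.Resolution
open AlgebraicGeometry.Scheme.IdealSheafData

namespace Summit.ResolutionOfSingularities.ResolutionOfSingularities.Cruxes.EquisingularLiftNat.Sections

/-! ## Translating and swapping a frame, with the relation recorded -/

/-- **Adapted coordinates, with the relation.** As `exists_translate_swap_coords` (…NatCarrierDeltaFrameAdapted), plus the explicit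
relation `c₀ i = c (swap 0 jj i) + w̃ i · c 0` (`w̃ = w` off `jj`, `w̃ jj = 0`). [folklore] -/
theorem exists_translate_swap_coords' {R S : Type*} [CommRing R] [CommRing S] (f : R →+* S) {r : ℕ}
    (c₀ : Fin (r + 1) → R) (jj : Fin (r + 1)) (w : Fin (r + 1) → R) (a : Fin (r + 1) → S) (hw : ∀ l, f (w l) = a l) :
    ∃ c : Fin (r + 1) → R, Ideal.span (Set.range c) = Ideal.span (Set.range c₀) ∧ c 0 = c₀ jj ∧
      (∀ l : Fin (r + 1), l ≠ 0 → ∃ m, m ≠ jj ∧ f (c l) = f (c₀ m) - a m * f (c₀ jj)) ∧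
      ∀ i, c₀ i = c (Equiv.swap 0 jj i) + Function.update w jj 0 i * c 0 := by
  classical
  set c₁ : Fin (r + 1) → R := fun l => c₀ l - Function.update w jj 0 l * c₀ jj with hc₁
  have hc₁jj : c₁ jj = c₀ jj := by simp [hc₁]
  have hspan₁ : Ideal.span (Set.range c₁) = Ideal.span (Set.range c₀) := by
    apply le_antisymm
    · rw [Ideal.span_le]
      rintro _ ⟨l, rfl⟩
      exact Ideal.sub_mem _ (Ideal.subset_span ⟨l, rfl⟩) (Ideal.mul_mem_left _ _ (Ideal.subset_span ⟨jj, rfl⟩))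
    · rw [Ideal.span_le]
      rintro _ ⟨l, rfl⟩
      have h : c₀ l = c₁ l + Function.update w jj 0 l * c₁ jj := by rw [hc₁jj]; simp [hc₁]
      rw [SetLike.mem_coe, h]
      exact Ideal.add_mem _ (Ideal.subset_span ⟨l, rfl⟩) (Ideal.mul_mem_left _ _ (Ideal.subset_span ⟨jj, rfl⟩))
  refine ⟨c₁ ∘ Equiv.swap 0 jj, by rw [(Equiv.swap 0 jj).surjective.range_comp, hspan₁],
    by rw [Function.comp_apply, Equiv.swap_apply_left, hc₁jj], fun l hl => ⟨Equiv.swap 0 jj l, ?_, ?_⟩, fun i => ?_⟩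
  · intro h
    apply hl
    have := congrArg (Equiv.swap 0 jj) h
    rwa [Equiv.swap_apply_self, Equiv.swap_apply_right] at this
  · have hm : Equiv.swap 0 jj l ≠ jj := by
      intro h
      apply hl
      have := congrArg (Equiv.swap 0 jj) h
      rwa [Equiv.swap_apply_self, Equiv.swap_apply_right] at this
    rw [Function.comp_apply, hc₁]
    simp only [map_sub, map_mul, Function.update_of_ne hm, hw]
  · rw [Function.comp_apply, Function.comp_apply, Equiv.swap_apply_self, Equiv.swap_apply_left, hc₁jj]
    simp [hc₁]

/-! ## T-FRAME-AT from a given frame -/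

section Frame

variable (O : Type) [CommRing O] [IsDomain O] [IsDiscreteValuationRing O]

set_option maxHeartbeats 800000 in -- chart algebra of a stalk = subalgebra of a localisation: slow instance unification (as p509910)
/-- **T-FRAME-AT′: the section frame adapted to a closed point `q′` of the exceptional divisor, from a GIVEN section frame.** As
`exists_sectionFrame_adapted` (…NatCarrierDeltaFrameAdapted) but starting from the given frame `c₀` (`(c₀) = 𝓘(s)_{j x}`) instead of an
arbitrary one, and recording that the adapted frame `c` is obtained from `c₀` by translating by CONSTANTS and swapping:
`c₀ i = c (swap 0 jj i) + ι(o i) · c 0` for some chart index `jj` and `o : Fin 3 → O`. [cite: StacksProject, Tag 0804] [OURS · L1 W4.5b] S7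
centred chain; NOT a statement of the manuscript. -/
theorem exists_sectionFrame_adapted_of_frame (k : Type) [Field k] [IsAlgClosed k] (θ : O →+* k) (hθ : Function.Surjective θ)
    {X' F₁ F₂ : Scheme.{0}} (r' : X' ⟶ Spec (.of O)) [IsSeparated r'] [LocallyOfFiniteType r'] [IsLocallyNoetherian X']
    (s : Spec (.of O) ⟶ X') (hs : s ≫ r' = 𝟙 _) (j : F₁ ⟶ X') (t : F₁ ⟶ Spec (.of k))
    (hsq : IsPullback j t r' (Spec.map (CommRingCat.ofHom θ))) (x : F₁) (hx : IsClosed ({x} : Set F₁))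
    (hss : s (IsLocalRing.closedPoint O) = j x) (hreg : IsRegularLocalRing (X'.presheaf.stalk (j x)))
    (hdim : ringKrullDim (X'.presheaf.stalk (j x)) = ((3 + 1 : ℕ) : WithBot ℕ∞)) (ϖ : O) (hϖ : Irreducible ϖ)
    (υ : F₂ ⟶ F₁) (hυ : IsBlowup υ (vanishingIdeal ⟨{x}, hx⟩)) (q' : F₂) (hq' : υ q' = x)
    (hq'c : IsClosed ({q'} : Set F₂))
    (c₀ : Fin 3 → X'.presheaf.stalk (j x)) (hcI₀ : Ideal.span (Set.range c₀) = stalkIdeal s.ker (j x)) :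
    ∃ (c : Fin 3 → X'.presheaf.stalk (j x)) (θR : (X'.presheaf.stalk (j x) ⧸ Ideal.span (Set.range c)) ≃+* O),
      Ideal.span (Set.range c) = stalkIdeal s.ker (j x) ∧ IsQuasiRegular c ∧
      IsDomain (X'.presheaf.stalk (j x) ⧸ Ideal.span (Set.range c)) ∧
      (∀ b : O, θR (Ideal.Quotient.mk _ ((X'.presheaf.Γgerm (j x)).hom
        (r'.appTop.hom ((Scheme.ΓSpecIso (.of O)).inv.hom b)))) = b) ∧
      Ideal.span (Set.range c) ⊔ Ideal.span {(X'.presheaf.Γgerm (j x)).hom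
        (r'.appTop.hom ((Scheme.ΓSpecIso (.of O)).inv.hom ϖ))} = maximalIdeal (X'.presheaf.stalk (j x)) ∧
      (X'.presheaf.Γgerm (j x)).hom (r'.appTop.hom ((Scheme.ΓSpecIso (.of O)).inv.hom ϖ)) ∉ Ideal.span (Set.range c) ∧
      -- the new frame is the translate-and-swap of the given one by CONSTANTS: `c₀ i = c (swap 0 jj i) + ι(o i) · c 0`
      (∃ (jj : Fin 3) (o : Fin 3 → O), ∀ i, c₀ i = c (Equiv.swap 0 jj i) +
        (X'.presheaf.Γgerm (j x)).hom (r'.appTop.hom ((Scheme.ΓSpecIso (.of O)).inv.hom (o i))) * c 0) ∧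
      ∃ (𝔔 : PrimeSpectrum (blowupAlgebra (Ideal.span (Set.range fun i => (j.stalkMap x).hom (c i)))
          ((j.stalkMap x).hom (c 0))))
        (χ : blowupAlgebra (Ideal.span (Set.range fun i => (j.stalkMap x).hom (c i))) ((j.stalkMap x).hom (c 0)) →+*
          F₂.presheaf.stalk q')
        (e : F₂.presheaf.stalk q' ≃+* Localization.AtPrime 𝔔.asIdeal),
        (∀ a, χ (algebraMap _ _ a) =
          ((F₁.presheaf.stalkCongr (Inseparable.of_eq hq')).inv ≫ υ.stalkMap q').hom a) ∧
        @IsLocalization.AtPrime _ _ (F₂.presheaf.stalk q') _ χ.toAlgebra 𝔔.asIdeal _ ∧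
        (∀ b, e (χ b) = algebraMap _ (Localization.AtPrime 𝔔.asIdeal) b) ∧
        𝔔.asIdeal.comap (algebraMap _ (blowupAlgebra (Ideal.span (Set.range fun i => (j.stalkMap x).hom (c i)))
          ((j.stalkMap x).hom (c 0)))) = maximalIdeal (F₁.presheaf.stalk x) ∧
        ∀ (l : {l : Fin 3 // l ≠ 0}) (y : blowupAlgebra (Ideal.span (Set.range fun i => (j.stalkMap x).hom (c i)))
            ((j.stalkMap x).hom (c 0))),
          (y : Localization.Away ((j.stalkMap x).hom (c 0))) =
            algebraMap _ (Localization.Away ((j.stalkMap x).hom (c 0))) ((j.stalkMap x).hom (c l.1)) *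
              IsLocalization.Away.invSelf ((j.stalkMap x).hom (c 0)) → y ∈ 𝔔.asIdeal := by
  classical
  subst hq'
  haveI : IsClosedImmersion (Spec.map (CommRingCat.ofHom θ)) := IsClosedImmersion.spec_of_surjective _ hθ
  haveI : IsClosedImmersion j := MorphismProperty.IsStableUnderBaseChange.of_isPullback hsq.flip inferInstance
  haveI : LocallyOfFiniteType t := MorphismProperty.IsStableUnderBaseChange.of_isPullback hsq inferInstance
  haveI : IsLocallyNoetherian F₁ := LocallyOfFiniteType.isLocallyNoetherian j
  haveI : IsProper υ := hυ.isProper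
  have hϖO : ϖ ∈ maximalIdeal O := by rw [hϖ.maximalIdeal_eq]; exact Ideal.mem_span_singleton_self ϖ
  -- (1′) the GIVEN frame; its clauses and its residue model `π₀ : O ↠ 𝒪_{F₁,x}/(c̄₀)`
  obtain ⟨θ₀, -, -, hθ₀, h𝔪₀, -⟩ := exists_sectionFrame_of_span_eq_forall_at O r' s hs (j (υ q')) hss hreg ϖ hϖ c₀ hcI₀ hdim
  have hcb₀𝔪 := span_stalkMap_eq_maximalIdeal_of_model θ hθ r' j t hsq (υ q') ϖ hϖO c₀ h𝔪₀
  obtain ⟨hπ₀, -⟩ := residueModel_surjective_and_ker θ hθ r' j t hsq (υ q') c₀ θ₀ hθ₀ hcb₀𝔪 rfl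
  -- the constants `ι : O → 𝒪_{X',j x}` (kept opaque: the goal is large)
  refine (⟨_, fun _ => rfl⟩ : ∃ ι : O → X'.presheaf.stalk (j (υ q')), ∀ b, ι b =
    (X'.presheaf.Γgerm (j (υ q'))).hom (r'.appTop.hom ((Scheme.ΓSpecIso (.of O)).inv.hom b))).elim fun ι hι => ?_
  have hcb₀J : Ideal.span (Set.range fun i => (j.stalkMap (υ q')).hom (c₀ i)) =
      stalkIdeal (vanishingIdeal ⟨{υ q'}, hx⟩) (υ q') := by
    rw [hcb₀𝔪, stalkIdeal_vanishingIdeal_singleton hx]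
  -- (2) a presentation of `q'` on some chart `jj`, and the values of the chart coordinates at `q'`
  have Hpres := hυ.exists_blowupAlgebra_stalk_ringEquiv q' (fun i => (j.stalkMap (υ q')).hom (c₀ i)) hcb₀J
  refine Hpres.elim fun jj H => H.elim fun 𝔔 H => H.elim fun χ H => H.elim fun e H => ?_
  have hχ := H.1
  have hloc := H.2.1
  have he := H.2.2.1
  have h𝔔 := H.2.2.2
  choose a ha using fun l : Fin 3 => exists_sub_algebraMap_mem_of_isClosed υ t q' hq'c hx 𝔔.asIdeal χ hχ hloc
    (blowupAlgebra.frac (fun i => (j.stalkMap (υ q')).hom (c₀ i)) jj l)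
  -- CONSTANT lifts of the values: `o l ∈ O` with `π₀ (o l) = a l mod (c̄₀)`, `w l := ι (o l)`
  choose o ho using fun l : Fin 3 =>
    hπ₀ (Ideal.Quotient.mk (Ideal.span (Set.range fun i => (j.stalkMap (υ q')).hom (c₀ i))) (a l))
  have ho' : ∀ l : Fin 3, Ideal.Quotient.mk (Ideal.span (Set.range fun i => (j.stalkMap (υ q')).hom (c₀ i))) (a l) =
      Ideal.Quotient.mk _ ((j.stalkMap (υ q')).hom (ι (o l))) := fun l => by
    rw [hι]; exact (ho l).symm
  have hdiff : ∀ l : Fin 3, a l - (j.stalkMap (υ q')).hom (ι (o l)) ∈ maximalIdeal (F₁.presheaf.stalk (υ q')) := fun l => by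
    rw [← hcb₀𝔪]; exact Ideal.Quotient.eq.mp (ho' l)
  have ha' : ∀ l : Fin 3, blowupAlgebra.frac (fun i => (j.stalkMap (υ q')).hom (c₀ i)) jj l -
      algebraMap _ _ ((j.stalkMap (υ q')).hom (ι (o l))) ∈ 𝔔.asIdeal := by
    intro l
    have hmem : algebraMap _ (blowupAlgebra (Ideal.span (Set.range fun i => (j.stalkMap (υ q')).hom (c₀ i)))
        ((j.stalkMap (υ q')).hom (c₀ jj))) (a l) - algebraMap _ _ ((j.stalkMap (υ q')).hom (ι (o l))) ∈ 𝔔.asIdeal := by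
      rw [← map_sub, ← Ideal.mem_comap, h𝔔]; exact hdiff l
    have h := Ideal.add_mem _ (ha l) hmem
    rwa [sub_add_sub_cancel] at h
  -- (3) the translated and swapped frame (only `refine`/`have` at top level: the goal is large)
  refine (exists_translate_swap_coords' (j.stalkMap (υ q')).hom c₀ jj (fun l => ι (o l))
    (fun l => (j.stalkMap (υ q')).hom (ι (o l))) (fun l => rfl)).elim fun c hcp => ?_
  have hcI : Ideal.span (Set.range c) = stalkIdeal s.ker (j (υ q')) := hcp.1.trans hcI₀
  refine (exists_sectionFrame_of_span_eq_forall_at O r' s hs (j (υ q')) hss hreg ϖ hϖ c hcI hdim).elim fun θR hfr => ?_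
  refine ⟨c, θR, hcI, hfr.1, hfr.2.1, hfr.2.2.1, hfr.2.2.2.1, hfr.2.2.2.2, ⟨jj, Function.update o jj 0, fun i => ?_⟩, ?_⟩
  · -- the translate-and-swap relation, with the constant `0` at the chart index
    rw [hcp.2.2.2 i, ← hι (Function.update o jj 0 i), Function.apply_update (fun _ b => ι b) o jj 0 i, hι 0, map_zero, map_zero,
      map_zero]
  -- (4) the presentation, transported to the chart algebra of the new frame
  have hIeq : Ideal.span (Set.range fun i => (j.stalkMap (υ q')).hom (c i)) =
      Ideal.span (Set.range fun i => (j.stalkMap (υ q')).hom (c₀ i)) := by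
    have h1 : (Set.range fun i => (j.stalkMap (υ q')).hom (c i)) = (j.stalkMap (υ q')).hom '' Set.range c :=
      Set.range_comp _ _
    have h2 : (Set.range fun i => (j.stalkMap (υ q')).hom (c₀ i)) = (j.stalkMap (υ q')).hom '' Set.range c₀ :=
      Set.range_comp _ _
    rw [h1, h2, ← Ideal.map_span, ← Ideal.map_span, hcp.1]
  have haeq : (j.stalkMap (υ q')).hom (c 0) = (j.stalkMap (υ q')).hom (c₀ jj) := by rw [hcp.2.1]
  have hφ : ∀ a', ((F₁.presheaf.stalkCongr (Inseparable.of_eq (rfl : υ q' = υ q'))).inv ≫ υ.stalkMap q').hom a' =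
      (υ.stalkMap q').hom a' := fun a' => by
    simp [TopCat.Presheaf.stalkCongr]
  refine blowupAlgebra_presentation_transport _ hIeq haeq (fun l : {l : Fin 3 // l ≠ 0} => (j.stalkMap (υ q')).hom (c l.1))
    ⟨𝔔, χ, e, fun a' => (hχ a').trans (hφ a').symm, hloc, he, h𝔔, fun l y hy => ?_⟩
  -- the element with numerator `c̄_l`, `l ≠ 0`, of the old chart algebra is `c̄₀_m/c̄₀_jj - a_m`, `m ≠ jj`
  refine (hcp.2.2.1 l.1 l.2).elim fun m hm => ?_
  rw [hm.2] at hy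
  have hy' := blowupAlgebra_eq_frac_sub_algebraMap (fun i => (j.stalkMap (υ q')).hom (c₀ i)) jj m
    ((j.stalkMap (υ q')).hom (ι (o m))) y hy
  rw [hy']
  exact ha' m

end Frame

end Summit.ResolutionOfSingularities.ResolutionOfSingularities.Cruxes.EquisingularLiftNat.Sections

end
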